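import Mathlib
import Summits.NavierStokesRegularity.NavierStokesRegularity.Theorems.TaoLadderRungTwoBreakBlowupRigidityOneTypeIEternalLimit
import HarnessLib

/-!
# ADMISSIBILITY PASSES TO THE ω-LIMIT: type I + per-shell action ceiling + energy ceiling + a clock-compatible
  centring ⇒ the ω-limit of the renormalised exact flow is an ADMISSIBLE (`IsEternal`) UNIFORMLY BOUNDED eternal
  solution — for the extraction stub `stub_eternalFromBlowup` of K2(1) `TaoLadderRungTwoBreak.BlowupRigidityOne`
  (stmt-NavierStokesRegularity-20206)

MODEL lattice ODEs only (Tao 2016 §4 (4.8)/(4.12), §6.4); nothing here is a statement about the Navier–Stokes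
equations; NO item is closed (`--supports stmt-NavierStokesRegularity-20206`). Route-independent; general `m`.

After `eternalLawLimit_of_typeI` (ω-limits exist under type I and solve the LAW of `IsEternal` on all of `ℝ`), this
file transports the two ADMISSIBILITY clauses of `IsEternal` to the limit, at ν = 0 and at a GENERAL per-shell
energy ratio `μ` (the viscous kit ⟨22744⟩ is the case `μ = (1+ε₀)⁻¹`, clock `(1+ε₀)^{-2m}`, ν > 0):

* `continuousOn_shellVec_of_contDiffOn` — shell vectors of a `C¹` flow are continuous on `[0,T)`;
* `translate_window_action` — ACTION OF A TRANSLATE OVER A WINDOW: `∫_a^b ‖W̃_k(u+s)‖ du ≤ Λ^k ∫_{[0,T)} ‖x_k‖ ≤ A`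
  (substitution `t = T - e^{-(u+s)}`), from the per-shell action ceiling `Λ^k ∫_{[0,T)} ‖x_k‖ ≤ A`;
* `translate_envelope` — ENVELOPE OF A TRANSLATE: `e^{2u} ‖W̃_{n+d}(u+s)‖² ≤ Cₑ · [(Λ²μ)^d e^{-2s}] · (Λ²μ)^n` from the
  energy ceiling `‖x_k(t)‖² ≤ Cₑ μ^k`;
* `admissibleEternalLimit_of_ceilings` — **ASSEMBLY**: exact flow on `[0,T)` + type I (`C`) + action ceiling (`A`) +
  energy ceiling (`μ, Cₑ`) + a centring `(d_j, s_j → ∞)` that is CLOCK-COMPATIBLE (`(Λ²μ)^{d_j} e^{-2 s_j} ≤ M`) ⇒ along a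
  subsequence the translates converge continuously to `W` with `IsEternal ε₀ α W`, `UniformBound W` (by `C`) and the
  explicit forward envelope `e^{2σ}‖W_n(σ)‖² ≤ Cₑ M (Λ²μ)^n` (Fatou on windows for the action; pointwise limits for the
  envelope).

HONEST LABEL: conditional on blow-up-side data that are OPEN for robust inviscid blow-up (type I = N-39; the ceilings =
the (E2) «pinning» data); forward SURVIVAL of the limit is the next file; `stub_eternalIsDSS` untouched. No stub, crux
or summit is proved here.
-/

noncomputable section

-- the summit and its single sub-problem share the name (CONVENTIONS §1)
set_option linter.dupNamespace false

open Set Filter Topology MeasureTheory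

namespace Summit.NavierStokesRegularity.NavierStokesRegularity.Theorems

namespace BlowupRigidityOne

open Literature.Analysis.FluidPDE Literature.Analysis.FluidPDE.TaoCascade

variable {m : ℕ}

/-- Shell vectors of a flow that is `C¹` on `[0,T)` are continuous on `[0,T)`. [folklore] -/
theorem continuousOn_shellVec_of_contDiffOn {T : ℝ} {X : Fin m → ℤ → ℝ → ℝ}
    (hC1 : ∀ i n, ContDiffOn ℝ 1 (X i n) (Set.Ico 0 T)) (k : ℤ) :
    ContinuousOn (shellVec X k) (Ico 0 T) := by
  have hc : ContinuousOn (fun t => fun i => X i k t) (Ico 0 T) :=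
    continuousOn_pi.2 fun i => (hC1 i k).continuousOn
  have h := (PiLp.continuous_toLp 2 (fun _ : Fin m => ℝ)).comp_continuousOn hc
  exact h

/-- **ACTION OF A TRANSLATE OVER A WINDOW.** For the renormalisation `W̃` of a `C¹` flow on `[0,T)` whose
per-shell action is bounded, `Λ^k ∫_{[0,T)} ‖x_k‖ ≤ A`, every log-time translate satisfies
`∫_a^b ‖W̃_k(u + s)‖ du ≤ A` on every window `[a,b]` with `e^{-(a+s)} < T` (substitution `t = T - e^{-(u+s)}`,
`dt = e^{-(u+s)} du`, and `‖W̃_k(σ)‖ = Λ^k e^{-σ} ‖x_k(T - e^{-σ})‖`).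
[cite: Tao2016AveragedNS, §6.4 with §4 (4.8); cell vocabulary (the `action` clause of `IsEternal`)] -/
theorem translate_window_action {ε₀ T : ℝ} (hε : 0 < ε₀) {X : Fin m → ℤ → ℝ → ℝ}
    (hC1 : ∀ i n, ContDiffOn ℝ 1 (X i n) (Set.Ico 0 T)) {W : ℤ → ℝ → Em m}
    (hW : ∀ n σ, W n σ = (bigLam ε₀ ^ n * Real.exp (-σ)) • shellVec X n (T - Real.exp (-σ)))
    {A : ℝ} (hact : ∀ k : ℤ, IntegrableOn (fun t => ‖shellVec X k t‖) (Ico 0 T) ∧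
      bigLam ε₀ ^ k * (∫ t in Ico 0 T, ‖shellVec X k t‖) ≤ A)
    (k : ℤ) (s : ℝ) {a b : ℝ} (hab : a ≤ b) (hwin : Real.exp (-(a + s)) < T) :
    ∫ u in a..b, ‖W k (u + s)‖ ≤ A := by
  have hΛ : 0 < bigLam ε₀ := bigLam_pos (by linarith)
  have hL : 0 < bigLam ε₀ ^ k := zpow_pos hΛ _
  -- the substitution `θ u = T − e^{-(u+s)}`
  have hθ' : ∀ u : ℝ, HasDerivAt (fun v => T - Real.exp (-(v + s))) (Real.exp (-(u + s))) u := by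
    intro u
    have h1 : HasDerivAt (fun v => Real.exp (-(v + s))) (Real.exp (-(u + s)) * (-1)) u := by
      have h := (((hasDerivAt_id u).add_const s).neg).exp
      simpa using h
    have h2 := h1.const_sub T
    have e : -(Real.exp (-(u + s)) * -1) = Real.exp (-(u + s)) := by ring
    rw [e] at h2
    exact h2
  have hθlow : ∀ u : ℝ, a ≤ u → 0 < T - Real.exp (-(u + s)) := by
    intro u hu
    have h1 : Real.exp (-(u + s)) ≤ Real.exp (-(a + s)) := Real.exp_le_exp.2 (by linarith)
    linarith
  have hθT : ∀ u : ℝ, T - Real.exp (-(u + s)) < T := fun u => by linarith [Real.exp_pos (-(u + s))]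
  have hθmono : ∀ u v : ℝ, u ≤ v → T - Real.exp (-(u + s)) ≤ T - Real.exp (-(v + s)) := by
    intro u v huv
    have h1 : Real.exp (-(v + s)) ≤ Real.exp (-(u + s)) := Real.exp_le_exp.2 (by linarith)
    linarith
  -- the integrand is `(g ∘ θ) · θ'` with `g t = Λ^k ‖x_k(t)‖`
  have heq : ∫ u in a..b, ‖W k (u + s)‖ =
      ∫ u in a..b, ((fun t => bigLam ε₀ ^ k * ‖shellVec X k t‖) ∘
          (fun v => T - Real.exp (-(v + s)))) u * Real.exp (-(u + s)) := by
    refine intervalIntegral.integral_congr fun u _ => ?_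
    simp only [Function.comp]
    rw [renormalisedFlow_norm hε hW]
    ring
  have hsub : (fun v => T - Real.exp (-(v + s))) '' (uIcc a b) ⊆ Ico 0 T := by
    rintro _ ⟨u, hu, rfl⟩
    rw [uIcc_of_le hab] at hu
    exact ⟨(hθlow u hu.1).le, hθT u⟩
  have hg : ContinuousOn (fun t => bigLam ε₀ ^ k * ‖shellVec X k t‖)
      ((fun v => T - Real.exp (-(v + s))) '' (uIcc a b)) :=
    (continuousOn_const.mul (continuousOn_shellVec_of_contDiffOn hC1 k).norm).mono hsub
  have hkey := intervalIntegral.integral_comp_mul_deriv' (a := a) (b := b) (fun u _ => hθ' u)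
    ((Real.continuous_exp.comp (continuous_id.add continuous_const).neg).continuousOn) hg
  rw [heq, hkey, intervalIntegral.integral_of_le (hθmono a b hab), integral_const_mul]
  -- compare with the action over `[0,T)`
  have hIoc : Ioc (T - Real.exp (-(a + s))) (T - Real.exp (-(b + s))) ⊆ Ico 0 T :=
    fun t ht => ⟨(hθlow a le_rfl).le.trans ht.1.le, lt_of_le_of_lt ht.2 (hθT b)⟩
  have hmono : ∫ t in Ioc (T - Real.exp (-(a + s))) (T - Real.exp (-(b + s))), ‖shellVec X k t‖
      ≤ ∫ t in Ico 0 T, ‖shellVec X k t‖ :=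
    setIntegral_mono_set (hact k).1 (ae_of_all _ fun t => norm_nonneg _) (ae_of_all _ hIoc)
  calc bigLam ε₀ ^ k * ∫ t in Ioc (T - Real.exp (-(a + s))) (T - Real.exp (-(b + s))), ‖shellVec X k t‖
      ≤ bigLam ε₀ ^ k * ∫ t in Ico 0 T, ‖shellVec X k t‖ := mul_le_mul_of_nonneg_left hmono hL.le
    _ ≤ A := (hact k).2

/-- `(Λ^k)² μ^k = (Λ² μ)^k` for integer `k`. [folklore] -/
theorem zpow_sq_mul_zpow (Λ μ : ℝ) (k : ℤ) :
    (Λ ^ k) ^ 2 * μ ^ k = (Λ ^ 2 * μ) ^ k := by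
  rw [mul_zpow, ← zpow_natCast (Λ ^ k) 2, ← zpow_mul, ← zpow_natCast Λ 2, ← zpow_mul]
  congr 1
  push_cast
  ring

/-- **ENVELOPE OF A TRANSLATE.** Under the ENERGY CEILING `‖x_k(t)‖² ≤ Cₑ μ^k` (`0 ≤ t < T`, all shells, `μ > 0`
the per-shell energy ratio), the renormalised translate centred at shell `d`, log-time `s` satisfies
`e^{2u} ‖W̃_{n+d}(u+s)‖² ≤ Cₑ · ((Λ²μ)^d e^{-2s}) · (Λ²μ)^n` on its window `e^{-(u+s)} < T`.
[cite: Tao2016AveragedNS, §6.4 with §4 (4.10); cell vocabulary (the `bdd` clause of `IsEternal`)] -/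
theorem translate_envelope {ε₀ T : ℝ} (hε : 0 < ε₀) {X : Fin m → ℤ → ℝ → ℝ} {W : ℤ → ℝ → Em m}
    (hW : ∀ n σ, W n σ = (bigLam ε₀ ^ n * Real.exp (-σ)) • shellVec X n (T - Real.exp (-σ)))
    {μ Cₑ : ℝ} (hμ : 0 < μ)
    (hE : ∀ (k : ℤ) (t : ℝ), 0 ≤ t → t < T → ‖shellVec X k t‖ ^ 2 ≤ Cₑ * μ ^ k)
    (n d : ℤ) (s u : ℝ) (hwin : Real.exp (-(u + s)) < T) :
    Real.exp (2 * u) * ‖W (n + d) (u + s)‖ ^ 2 ≤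
      Cₑ * ((bigLam ε₀ ^ 2 * μ) ^ d * Real.exp (-(2 * s))) * (bigLam ε₀ ^ 2 * μ) ^ n := by
  have hΛ : 0 < bigLam ε₀ := bigLam_pos (by linarith)
  have hq : 0 < bigLam ε₀ ^ 2 * μ := by positivity
  set t : ℝ := T - Real.exp (-(u + s)) with ht_def
  have ht0 : 0 ≤ t := by rw [ht_def]; linarith
  have htT : t < T := by rw [ht_def]; linarith [Real.exp_pos (-(u + s))]
  have hx := hE (n + d) t ht0 htT
  have hCₑ : 0 ≤ Cₑ := by
    have := (sq_nonneg ‖shellVec X (n + d) t‖).trans hx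
    exact nonneg_of_mul_nonneg_left this (zpow_pos hμ _) |> fun h => by
      rcases le_or_gt 0 Cₑ with h0 | h0
      · exact h0
      · exact absurd this (not_le.2 (mul_neg_of_neg_of_pos h0 (zpow_pos hμ _)))
  -- `e^{2u} ‖W̃‖² = (Λ^{n+d})² e^{-2s} ‖x(t)‖²`
  have hnorm : Real.exp (2 * u) * ‖W (n + d) (u + s)‖ ^ 2 =
      (bigLam ε₀ ^ (n + d)) ^ 2 * Real.exp (-(2 * s)) * ‖shellVec X (n + d) t‖ ^ 2 := by
    rw [renormalisedFlow_norm hε hW, ← ht_def]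
    have e1 : Real.exp (2 * u) = Real.exp u ^ 2 := by rw [← Real.exp_nat_mul]; norm_num
    have e2 : Real.exp (-(u + s)) = (Real.exp u)⁻¹ * (Real.exp s)⁻¹ := by
      rw [neg_add, Real.exp_add, Real.exp_neg, Real.exp_neg]
    have e3 : Real.exp (-(2 * s)) = ((Real.exp s)⁻¹) ^ 2 := by
      rw [← Real.exp_neg, ← Real.exp_nat_mul]; norm_num
    rw [e1, e2, e3]
    have hu0 : Real.exp u ≠ 0 := (Real.exp_pos u).ne'
    field_simp
  rw [hnorm]
  -- `(Λ^{n+d})² μ^{n+d} = (Λ²μ)^{n+d} = (Λ²μ)^d (Λ²μ)^n`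
  have hsplit : (bigLam ε₀ ^ (n + d)) ^ 2 = (bigLam ε₀ ^ 2 * μ) ^ d * (bigLam ε₀ ^ 2 * μ) ^ n * (μ ^ (n + d))⁻¹ := by
    have hμk : μ ^ (n + d) ≠ 0 := (zpow_pos hμ _).ne'
    rw [eq_mul_inv_iff_mul_eq₀ hμk, zpow_sq_mul_zpow (bigLam ε₀) μ, zpow_add₀ hq.ne', mul_comm]
  rw [hsplit]
  have hμk : 0 < μ ^ (n + d) := zpow_pos hμ _
  calc (bigLam ε₀ ^ 2 * μ) ^ d * (bigLam ε₀ ^ 2 * μ) ^ n * (μ ^ (n + d))⁻¹ * Real.exp (-(2 * s))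
        * ‖shellVec X (n + d) t‖ ^ 2
      = (bigLam ε₀ ^ 2 * μ) ^ d * Real.exp (-(2 * s)) * (bigLam ε₀ ^ 2 * μ) ^ n
          * (‖shellVec X (n + d) t‖ ^ 2 / μ ^ (n + d)) := by rw [div_eq_mul_inv]; ring
    _ ≤ (bigLam ε₀ ^ 2 * μ) ^ d * Real.exp (-(2 * s)) * (bigLam ε₀ ^ 2 * μ) ^ n * Cₑ := by
        refine mul_le_mul_of_nonneg_left ?_ (by positivity)
        rw [div_le_iff₀ hμk]
        exact hx
    _ = Cₑ * ((bigLam ε₀ ^ 2 * μ) ^ d * Real.exp (-(2 * s))) * (bigLam ε₀ ^ 2 * μ) ^ n := by ring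

/-- **ADMISSIBLE UNIFORMLY BOUNDED ETERNAL ω-LIMIT FROM TYPE I + CEILINGS + A CLOCK-COMPATIBLE CENTRING.**
Let `X` be an exact flow on `[0,T)`, `T > 0`, `W̃` its renormalisation, and assume: TYPE I (`Λ^n(T-t)‖x_n(t)‖ ≤ C`);
the per-shell ACTION CEILING `Λ^k ∫_{[0,T)} ‖x_k‖ ≤ A`; the ENERGY CEILING `‖x_k(t)‖² ≤ Cₑ μ^k` (`μ > 0`); and a
centring `(d_j ∈ ℤ, s_j → +∞)` with `(Λ²μ)^{d_j} e^{-2 s_j} ≤ M` (CLOCK-COMPATIBLE: the frame at shell `d_j` is opened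
no later than that shell's self-similar time). Then along a subsequence the translates `W̃_{n+d_j}(· + s_j)` converge
continuously to `W : ℤ → ℝ → ℝ^m` which is an ADMISSIBLE ETERNAL SOLUTION `IsEternal ε₀ α W` (law on all of `ℝ`;
uniform action `∫_ℝ ‖W_n‖ ≤ A`; forward envelope), UNIFORMLY BOUNDED (`‖W_n(σ)‖ ≤ C`), with the explicit envelope
`e^{2σ} ‖W_n(σ)‖² ≤ Cₑ M (Λ²μ)^n` at every `σ`.
[cite: Tao2016AveragedNS, §4 Thm. 4.2 (statement shape), (4.8)–(4.10), §6.4; KochNadirashviliSereginSverak2009, Thm 1.1 ff. (rescaling-compactness); Teschl2012, §2.6; cell vocabulary (`IsEternal`, `UniformBound`)] -/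
theorem admissibleEternalLimit_of_ceilings {ε₀ T C A μ Cₑ M : ℝ} (hε : 0 < ε₀) (hT : 0 < T)
    {α : Fin m → Fin m → Fin m → ℤ × ℤ × ℤ → ℝ}
    {X : Fin m → ℤ → ℝ → ℝ} (hC1 : ∀ i n, ContDiffOn ℝ 1 (X i n) (Set.Ico 0 T))
    (hmot : ∀ i n t, 0 ≤ t → t < T → derivWithin (X i n) (Set.Ici 0) t = quadTerm ε₀ α X i n t)
    {W : ℤ → ℝ → Em m}
    (hW : ∀ n σ, W n σ = (bigLam ε₀ ^ n * Real.exp (-σ)) • shellVec X n (T - Real.exp (-σ)))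
    (htypeI : ∀ (n : ℤ) (t : ℝ), 0 ≤ t → t < T → bigLam ε₀ ^ n * (T - t) * ‖shellVec X n t‖ ≤ C)
    (hact : ∀ k : ℤ, IntegrableOn (fun t => ‖shellVec X k t‖) (Ico 0 T) ∧
      bigLam ε₀ ^ k * (∫ t in Ico 0 T, ‖shellVec X k t‖) ≤ A)
    (hμ : 0 < μ) (hE : ∀ (k : ℤ) (t : ℝ), 0 ≤ t → t < T → ‖shellVec X k t‖ ^ 2 ≤ Cₑ * μ ^ k)
    (d : ℕ → ℤ) (s : ℕ → ℝ) (hs : Tendsto s atTop atTop)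
    (hM : ∀ j : ℕ, (bigLam ε₀ ^ 2 * μ) ^ (d j) * Real.exp (-(2 * s j)) ≤ M) :
    ∃ φ : ℕ → ℕ, StrictMono φ ∧ ∃ Wlim : ℤ → ℝ → Em m,
      (∀ (n : ℤ) (u : ℕ → ℝ) (σ : ℝ), Tendsto u atTop (𝓝 σ) →
        Tendsto (fun j => W (n + d (φ j)) (u j + s (φ j))) atTop (𝓝 (Wlim n σ))) ∧
      IsEternal ε₀ α Wlim ∧ UniformBound Wlim ∧ (∀ (n : ℤ) (σ : ℝ), ‖Wlim n σ‖ ≤ C) ∧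
      (∀ (n : ℤ) (σ : ℝ), Real.exp (2 * σ) * ‖Wlim n σ‖ ^ 2 ≤ Cₑ * M * (bigLam ε₀ ^ 2 * μ) ^ n) := by
  obtain ⟨φ, hφ, Wlim, hconv, hlaw, hbdd⟩ := eternalLawLimit_of_typeI hε hT hC1 hmot hW htypeI d s hs
  have hs' : Tendsto (fun j => s (φ j)) atTop atTop := hs.comp hφ.tendsto_atTop
  -- pointwise limits and continuity of the limit shells
  have hpt : ∀ (n : ℤ) (σ : ℝ), Tendsto (fun j => W (n + d (φ j)) (σ + s (φ j))) atTop (𝓝 (Wlim n σ)) :=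
    fun n σ => hconv n (fun _ => σ) σ tendsto_const_nhds
  have hcont : ∀ n : ℤ, Continuous (Wlim n) := fun n =>
    continuous_iff_continuousAt.2 fun σ => (hlaw n σ).continuousAt
  -- the windows open eventually: `e^{-(a + s_{φ j})} < T`
  have hev : ∀ a : ℝ, ∀ᶠ j in atTop, Real.exp (-(a + s (φ j))) < T := by
    intro a
    refine (hs'.eventually (eventually_gt_atTop (-Real.log T - a))).mono fun j hj => ?_
    calc Real.exp (-(a + s (φ j))) < Real.exp (Real.log T) := Real.exp_lt_exp.2 (by linarith)
      _ = T := Real.exp_log hT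
  have hwu : ∀ (j : ℕ) (a u : ℝ), Real.exp (-(a + s (φ j))) < T → a ≤ u →
      Real.exp (-(u + s (φ j))) < T := by
    intro j a u hj hu
    exact lt_of_le_of_lt (Real.exp_le_exp.2 (by linarith)) hj
  -- continuity of the translates on their windows (from the half-line law)
  have hcontT : ∀ (j : ℕ) (n : ℤ) (u : ℝ), Real.exp (-(u + s (φ j))) < T →
      ContinuousAt (fun v => W (n + d (φ j)) (v + s (φ j))) u := by
    intro j n u hu
    exact ((renormalisedFlow_law hε hC1 hmot hW (n + d (φ j)) hu).comp_add_const u (s (φ j))).continuousAt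
  -- ACTION on finite windows in the limit
  have hwin_int : ∀ (n : ℤ) (a b : ℝ), a ≤ b → ∫ u in a..b, ‖Wlim n u‖ ≤ A := by
    intro n a b hab
    have hlim : Tendsto (fun j => ∫ u in a..b, ‖W (n + d (φ j)) (u + s (φ j))‖) atTop
        (𝓝 (∫ u in a..b, ‖Wlim n u‖)) := by
      refine intervalIntegral.tendsto_integral_filter_of_dominated_convergence (fun _ => C) ?_ ?_
        intervalIntegrable_const ?_
      · refine (hev a).mono fun j hj => ?_
        refine ContinuousOn.aestronglyMeasurable ?_ measurableSet_uIoc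
        intro u hu
        rw [Set.uIoc_of_le hab] at hu
        exact ((hcontT j n u (hwu j a u hj hu.1.le)).norm).continuousWithinAt
      · refine (hev a).mono fun j hj => ae_of_all _ fun u hu => ?_
        rw [Set.uIoc_of_le hab] at hu
        rw [norm_norm]
        exact (uniformBound_iff_typeI (C := C) hε hW).2 htypeI (n + d (φ j)) (u + s (φ j))
          (hwu j a u hj hu.1.le).le
      · exact ae_of_all _ fun u _ => (hpt n u).norm
    exact le_of_tendsto hlim ((hev a).mono fun j hj =>
      translate_window_action hε hC1 hW hact (n + d (φ j)) (s (φ j)) hab hj)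
  -- integrability on `ℝ` and the total action
  have haction : ∀ n : ℤ, Integrable (fun σ => ‖Wlim n σ‖) ∧ ∫ σ, ‖Wlim n σ‖ ≤ A := by
    intro n
    have hcn : Continuous (fun σ => ‖Wlim n σ‖) := (hcont n).norm
    have hfi : ∀ i : ℕ, IntegrableOn (fun σ => ‖Wlim n σ‖) (Ioc (-(i : ℝ)) i) := fun i =>
      (hcn.integrableOn_Icc).mono_set Ioc_subset_Icc_self
    have ha : Tendsto (fun i : ℕ => -(i : ℝ)) atTop atBot :=
      tendsto_neg_atTop_atBot.comp tendsto_natCast_atTop_atTop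
    have hb : Tendsto (fun i : ℕ => (i : ℝ)) atTop atTop := tendsto_natCast_atTop_atTop
    have hii : ∀ i : ℕ, -(i : ℝ) ≤ i := fun i => by
      have h0 : (0 : ℝ) ≤ i := Nat.cast_nonneg i
      linarith
    have hInt : Integrable (fun σ => ‖Wlim n σ‖) := by
      refine integrable_of_intervalIntegral_norm_bounded A hfi ha hb (Eventually.of_forall fun i => ?_)
      simp only [norm_norm]
      exact hwin_int n _ _ (hii i)
    exact ⟨hInt, le_of_tendsto' (intervalIntegral_tendsto_integral hInt ha hb) fun i => hwin_int n _ _ (hii i)⟩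
  -- ENVELOPE in the limit
  have henv : ∀ (n : ℤ) (σ : ℝ), Real.exp (2 * σ) * ‖Wlim n σ‖ ^ 2 ≤ Cₑ * M * (bigLam ε₀ ^ 2 * μ) ^ n := by
    intro n σ
    have hΛ : 0 < bigLam ε₀ := bigLam_pos (by linarith)
    have hq : 0 < (bigLam ε₀ ^ 2 * μ) ^ n := zpow_pos (by positivity) _
    refine le_of_tendsto ((((hpt n σ).norm).pow 2).const_mul (Real.exp (2 * σ)))
      ((hev σ).mono fun j hj => ?_)
    have h1 := translate_envelope hε hW hμ hE n (d (φ j)) (s (φ j)) σ hj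
    -- `Cₑ ≥ 0` from the ceiling at the datum time
    have hCₑ : 0 ≤ Cₑ * (bigLam ε₀ ^ 2 * μ) ^ n := by
      have h0 := hE 0 0 le_rfl hT
      have : 0 ≤ Cₑ := by
        have h' : 0 ≤ Cₑ * μ ^ (0 : ℤ) := (sq_nonneg _).trans h0
        simpa using h'
      exact mul_nonneg this hq.le
    calc Real.exp (2 * σ) * ‖W (n + d (φ j)) (σ + s (φ j))‖ ^ 2
        ≤ Cₑ * ((bigLam ε₀ ^ 2 * μ) ^ (d (φ j)) * Real.exp (-(2 * s (φ j)))) * (bigLam ε₀ ^ 2 * μ) ^ n := h1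
      _ = (bigLam ε₀ ^ 2 * μ) ^ (d (φ j)) * Real.exp (-(2 * s (φ j))) * (Cₑ * (bigLam ε₀ ^ 2 * μ) ^ n) := by
          ring
      _ ≤ M * (Cₑ * (bigLam ε₀ ^ 2 * μ) ^ n) := mul_le_mul_of_nonneg_right (hM (φ j)) hCₑ
      _ = Cₑ * M * (bigLam ε₀ ^ 2 * μ) ^ n := by ring
  refine ⟨φ, hφ, Wlim, hconv, ⟨hlaw, ⟨A, haction⟩, fun n => ⟨0, Cₑ * M * (bigLam ε₀ ^ 2 * μ) ^ n,
    fun σ _ => henv n σ⟩⟩, ⟨C, hbdd⟩, hbdd, henv⟩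

end BlowupRigidityOne

end Summit.NavierStokesRegularity.NavierStokesRegularity.Theorems

end
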